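import Summits.QuantumFields.YangMills.Theorems.IR.Negative.OuterCertFalseOfWire

/-!
# `¬ OuterCertificate` modulo a boundary-order wire, II: two kernels and the two-sided tube

Companion to `OuterCertFalseOfWire` (Q-g18 typed kill attempt on v10 `stub_outerCert : IROuterCertificate`,
crux `IR`, item `stmt-QuantumFields-19354`; memo `NOT-REFUTED.md` on that item).  That file types the
hypothesis H = `BoundaryOrderWire ρ` (a ONE-sided wire whose two phase-selecting sets of cap data are massive
under ONE Wilson kernel) and proves `H → ¬ OuterCertificate r a`.  This file records H in the weaker, final
form actually probed numerically (kit jobs j254799 / j254983 / j254961 / j255182: two-sided tube with ideal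
caps at both ends) and proves the same kills:

* `WireAt'` — one-sided wire, the two phase-selecting cap sets `S₀, S₁` massive under two possibly different
  kernels / exteriors (clause (ii) of `OuterTemperedCond` is uniform in the kernel and the exterior, so this
  costs nothing in the proof); `wireAt'_of_wireAt : WireAt → WireAt'`.
* `WireAt₂` — TWO-sided wire: two distinct cap cells `cs₁ ≠ cs₂` in the outer shell, the centre cell in the
  middle of the tube, phase `0` selected by cap data from `S₀₁ × S₀₂`, phase `1` by `S₁₁ × S₁₂` (double splice
  `splice₂`).
* `BoundaryOrderWire' ρ := ∃ δ > 0, ∃ b₀ β₀, ∀ b ≥ b₀, ∀ β ≥ β₀, ∀ n ≥ 1, WireAt' ρ β b n δ ∨ WireAt₂ ρ β b n δ`,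
  implied by `BoundaryOrderWire ρ`.
* `not_outerTemperedCond_of_wireAt'`, `not_outerTemperedCond_of_wireAt₂` (any `ε < 1/3`),
  `outerCertificate_false_of_wire' : BoundaryOrderWire' r.ρ → (∀ β, 0 < a β) → a → 0 → ¬ OuterCertificate r a`,
  and the #31 shapes `irOuterCertificate_false_of_witness'`, `irOuterCertificate_false_of_nt_of_wireSU2'`.

Nothing here asserts a Theses statement; H is NOT proved (it is a statement about 4-D `SU(2)` lattice gauge
theory at weak coupling, and the memo's lattice-scale probes found no wire).  Standard axioms only.
-/

noncomputable section

open Filter Topology MeasureTheory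
open Literature.MathematicalPhysics.QuantumFieldTheory Literature.MathematicalPhysics.QuantumLattice
open Summit.QuantumFields.YangMills.Cruxes.OSLegsFromFemtoAndGap.DlrCollarTransfer (GapInUnits LowerBounds)
open Summit.QuantumFields.YangMills.Cruxes.IR.Tempered (cellEdges windowCells regionEdges)
open Summit.QuantumFields.YangMills.Cruxes.IR.ShellTempered (windowCellsPlus)

namespace Summit.QuantumFields.YangMills.Cruxes.IR.OuterCertWire

section Defs

variable {G : Type} [Group G] [TopologicalSpace G] [IsTopologicalGroup G] [CompactSpace G]
  [MeasurableSpace G] [BorelSpace G]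

/-! ## §1 Generalised wires -/

/-- **Boundary-order wire at one parameter point, two kernels** (generalises `WireAt`, see
`wireAt'_of_wireAt`) `(ρ, β, b, n, δ)`: a frame `w` of mesh `b`, a tube of
cells `Y ⊆ windowCells n` containing the centre, a cap cell `cs` in the outer shell, a wall datum `σW`, a
`[0,1]`-valued measurable centre-cell cylinder `f`, and two phase-selecting sets `S₀, S₁` of cap data,
`Sᵢ` of mass `> δ` under SOME Wilson kernel `γ_{Eᵢ}(·|ζᵢ)` with `cellEdges w cs ⊆ Eᵢ` (two kernels, two
exteriors: clause (ii) is uniform in both), such that every cap datum from `S₀` spliced into `σW` gives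
`∫ f dγ_{regionEdges w Y} ≤ 1/3` and every one from `S₁` gives `≥ 2/3` (one-sided tube: one cap differs). -/
def WireAt' {N : ℕ} (ρ : G →* Matrix (Fin N) (Fin N) ℂ) (β : ℝ) (b n : ℕ) (δ : ℝ) : Prop :=
  ∃ w : Fin 4 → ℤ → ℤ, (∀ i j, w i j + ((b : ℕ) : ℤ) ≤ w i (j + 1) ∧ w i (j + 1) ≤ w i j + 2 * ((b : ℕ) : ℤ)) ∧
    ∃ (Y : Finset (Fin 4 → ℤ)) (cs : Fin 4 → ℤ) (σW : LGConfig 4 G) (f : LGConfig 4 G → ℝ)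
      (E₀ E₁ : Finset (Literature.MathematicalPhysics.QuantumLattice.ZdEdge 4)) (ζ₀ ζ₁ : LGConfig 4 G)
      (S₀ S₁ : Set (LGConfig 4 G)),
      Y ⊆ windowCells n ∧ (0 : Fin 4 → ℤ) ∈ Y ∧ cs ∈ windowCellsPlus n ∧ cs ∉ windowCells n ∧
      IsCylinder f (cellEdges w 0) ∧ Measurable f ∧ (∀ U, 0 ≤ f U ∧ f U ≤ 1) ∧
      cellEdges w cs ⊆ E₀ ∧ cellEdges w cs ⊆ E₁ ∧
      ENNReal.ofReal δ < ymSpecification ρ β E₀ ζ₀ S₀ ∧ ENNReal.ofReal δ < ymSpecification ρ β E₁ ζ₁ S₁ ∧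
      (∀ τ ∈ S₀, ∫ U, f U ∂(ymSpecification ρ β (regionEdges w Y) (splice w cs σW τ)) ≤ 1 / 3) ∧
      (∀ τ ∈ S₁, 2 / 3 ≤ ∫ U, f U ∂(ymSpecification ρ β (regionEdges w Y) (splice w cs σW τ)))

/-- Double splice: `τ₁` on the edges of cell `cs₁`, then `τ₂` on the edges of cell `cs₂`, `σW` elsewhere. -/
def splice₂ (w : Fin 4 → ℤ → ℤ) (cs₁ cs₂ : Fin 4 → ℤ) (σW τ₁ τ₂ : LGConfig 4 G) : LGConfig 4 G :=
  splice w cs₂ (splice w cs₁ σW τ₁) τ₂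

/-- **Two-sided boundary-order wire at one parameter point**: as `WireAt'`, but the tube `Y` has TWO distinct cap
cells `cs₁ ≠ cs₂` in the outer shell (e.g. `Y = {k e₀ : |k| ≤ 2n}`, caps `±(2n+1)e₀`, centre cell in the
middle), phase `0` is selected by cap data from `S₀¹ × S₀²` and phase `1` by data from `S₁¹ × S₁²`, each of the
four sets having mass `> δ` under some Wilson kernel containing its cap cell. -/
def WireAt₂ {N : ℕ} (ρ : G →* Matrix (Fin N) (Fin N) ℂ) (β : ℝ) (b n : ℕ) (δ : ℝ) : Prop :=
  ∃ w : Fin 4 → ℤ → ℤ, (∀ i j, w i j + ((b : ℕ) : ℤ) ≤ w i (j + 1) ∧ w i (j + 1) ≤ w i j + 2 * ((b : ℕ) : ℤ)) ∧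
    ∃ (Y : Finset (Fin 4 → ℤ)) (cs₁ cs₂ : Fin 4 → ℤ) (σW : LGConfig 4 G) (f : LGConfig 4 G → ℝ)
      (E₀₁ E₀₂ E₁₁ E₁₂ : Finset (Literature.MathematicalPhysics.QuantumLattice.ZdEdge 4))
      (ζ₀₁ ζ₀₂ ζ₁₁ ζ₁₂ : LGConfig 4 G) (S₀₁ S₀₂ S₁₁ S₁₂ : Set (LGConfig 4 G)),
      Y ⊆ windowCells n ∧ (0 : Fin 4 → ℤ) ∈ Y ∧ cs₁ ≠ cs₂ ∧
      cs₁ ∈ windowCellsPlus n ∧ cs₁ ∉ windowCells n ∧ cs₂ ∈ windowCellsPlus n ∧ cs₂ ∉ windowCells n ∧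
      IsCylinder f (cellEdges w 0) ∧ Measurable f ∧ (∀ U, 0 ≤ f U ∧ f U ≤ 1) ∧
      cellEdges w cs₁ ⊆ E₀₁ ∧ cellEdges w cs₂ ⊆ E₀₂ ∧ cellEdges w cs₁ ⊆ E₁₁ ∧ cellEdges w cs₂ ⊆ E₁₂ ∧
      ENNReal.ofReal δ < ymSpecification ρ β E₀₁ ζ₀₁ S₀₁ ∧ ENNReal.ofReal δ < ymSpecification ρ β E₀₂ ζ₀₂ S₀₂ ∧
      ENNReal.ofReal δ < ymSpecification ρ β E₁₁ ζ₁₁ S₁₁ ∧ ENNReal.ofReal δ < ymSpecification ρ β E₁₂ ζ₁₂ S₁₂ ∧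
      (∀ τ₁ ∈ S₀₁, ∀ τ₂ ∈ S₀₂,
        ∫ U, f U ∂(ymSpecification ρ β (regionEdges w Y) (splice₂ w cs₁ cs₂ σW τ₁ τ₂)) ≤ 1 / 3) ∧
      (∀ τ₁ ∈ S₁₁, ∀ τ₂ ∈ S₁₂,
        2 / 3 ≤ ∫ U, f U ∂(ymSpecification ρ β (regionEdges w Y) (splice₂ w cs₁ cs₂ σW τ₁ τ₂)))

/-- **Boundary-order wire, final form of hypothesis H** of the Q-g18 memo (implied by `BoundaryOrderWire`,
see `boundaryOrderWire'_of_boundaryOrderWire`): one rarity level `δ > 0` and thresholds `b₀, β₀` beyond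
which a one-sided (two-kernel) OR a two-sided wire exists for every cell size `b ≥ b₀`, every `β ≥ β₀` and
every window radius `n ≥ 1`. -/
def BoundaryOrderWire' {N : ℕ} (ρ : G →* Matrix (Fin N) (Fin N) ℂ) : Prop :=
  ∃ δ : ℝ, 0 < δ ∧ ∃ (b₀ : ℕ) (β₀ : ℝ),
    ∀ b : ℕ, b₀ ≤ b → ∀ β : ℝ, β₀ ≤ β → ∀ n : ℕ, 1 ≤ n → WireAt' ρ β b n δ ∨ WireAt₂ ρ β b n δ

/-- `WireAt` (one kernel) is the special case `E₁ = E₀, ζ₁ = ζ₀` of `WireAt'`. -/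
theorem wireAt'_of_wireAt {N : ℕ} {ρ : G →* Matrix (Fin N) (Fin N) ℂ} {β : ℝ} {b n : ℕ} {δ : ℝ}
    (h : WireAt ρ β b n δ) : WireAt' ρ β b n δ := by
  obtain ⟨w, hw, Y, cs, σW, f, E₀, ζ₀, S₀, S₁, hY, h0Y, hcs₁, hcs₂, hfcyl, hfmeas, hf01, hE₀, hS₀, hS₁,
    hlo, hhi⟩ := h
  exact ⟨w, hw, Y, cs, σW, f, E₀, E₀, ζ₀, ζ₀, S₀, S₁, hY, h0Y, hcs₁, hcs₂, hfcyl, hfmeas, hf01, hE₀, hE₀,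
    hS₀, hS₁, hlo, hhi⟩

/-- Hence `BoundaryOrderWire ρ → BoundaryOrderWire' ρ` (the final form of H is the weaker hypothesis). -/
theorem boundaryOrderWire'_of_boundaryOrderWire {N : ℕ} {ρ : G →* Matrix (Fin N) (Fin N) ℂ}
    (h : BoundaryOrderWire ρ) : BoundaryOrderWire' ρ := by
  obtain ⟨δ, hδ, b₀, β₀, hW⟩ := h
  exact ⟨δ, hδ, b₀, β₀, fun b hb β hβ n hn => Or.inl (wireAt'_of_wireAt (hW b hb β hβ n hn))⟩

/-! ## §2 The kills -/

/-- **The wire at one point kills the outer-tempered condition there** (any `ε < 1/3`). -/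
theorem not_outerTemperedCond_of_wireAt' {N : ℕ} {ρ : G →* Matrix (Fin N) (Fin N) ℂ} {β : ℝ} {b n : ℕ}
    {ε δ : ℝ} (hW : WireAt' ρ β b n δ) (hε : ε < 1 / 3) : ¬ OuterTemperedCond ρ β b n ε δ := by
  intro hO
  obtain ⟨w, hw, Y, cs, σW, f, E₀, E₁, ζ₀, ζ₁, S₀, S₁, hY, h0Y, hcs₁, hcs₂, hfcyl, hfmeas, hf01, hE₀, hE₁,
    hS₀, hS₁, hlo, hhi⟩ := hW
  obtain ⟨Good, -, hGdep, hmix, hrare⟩ := hO w hw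
  -- (ii) forces `Good cs` to meet every set of mass `> δ` under any kernel containing the cap cell
  have meet : ∀ (E' : Finset (Literature.MathematicalPhysics.QuantumLattice.ZdEdge 4)) (ζ : LGConfig 4 G)
      (S : Set (LGConfig 4 G)), cellEdges w cs ⊆ E' → ENNReal.ofReal δ < ymSpecification ρ β E' ζ S →
      ∃ τ ∈ S, τ ∈ Good cs := by
    intro E' ζ S hE' hS
    by_contra h
    have hsub : S ⊆ (Good cs)ᶜ := fun τ hτ hτG => h ⟨τ, hτ, hτG⟩
    exact lt_irrefl _ (lt_of_lt_of_le hS ((measure_mono hsub).trans (hrare cs E' hE' ζ)))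
  obtain ⟨τ₀, hτ₀S, hτ₀G⟩ := meet E₀ ζ₀ S₀ hE₀ hS₀
  obtain ⟨τ₁, hτ₁S, hτ₁G⟩ := meet E₁ ζ₁ S₁ hE₁ hS₁
  have hsp_in : ∀ τ : LGConfig 4 G, ∀ e ∈ cellEdges w cs, splice w cs σW τ e = τ e :=
    fun τ e he => by simp [splice, he]
  have hsp_out : ∀ τ : LGConfig 4 G, ∀ e, e ∉ cellEdges w cs → splice w cs σW τ e = σW e :=
    fun τ e he => by simp [splice, he]
  -- the splice of a good cap datum is good (`Good cs` is determined by the cap cell's edges)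
  have good_splice : ∀ τ, τ ∈ Good cs → splice w cs σW τ ∈ Good cs := by
    intro τ hτ
    exact (hGdep cs (fun e he => hsp_in τ e (Finset.mem_coe.1 he))).mpr hτ
  -- the two spliced data agree off `cs` and are both good on `cs`
  have hagree : ∀ c ∈ windowCellsPlus n, c ∉ Y →
      ((∀ e ∈ cellEdges w c, splice w cs σW τ₀ e = splice w cs σW τ₁ e) ∨
        (c ∉ windowCells n ∧ splice w cs σW τ₀ ∈ Good c ∧ splice w cs σW τ₁ ∈ Good c)) := by
    intro c _ _
    by_cases hccs : c = cs
    · subst hccs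
      exact Or.inr ⟨hcs₂, good_splice τ₀ hτ₀G, good_splice τ₁ hτ₁G⟩
    · exact Or.inl fun e he => by
        rw [hsp_out τ₀ e (not_mem_cellEdges_of_ne hw hccs he),
          hsp_out τ₁ e (not_mem_cellEdges_of_ne hw hccs he)]
  have key := hmix Y hY h0Y _ _ hagree f hfcyl hfmeas hf01
  have h1 := hlo τ₀ hτ₀S
  have h2 := hhi τ₁ hτ₁S
  have h3 : (1 : ℝ) / 3 ≤ |(∫ U, f U ∂(ymSpecification ρ β (regionEdges w Y) (splice w cs σW τ₀))) -
      ∫ U, f U ∂(ymSpecification ρ β (regionEdges w Y) (splice w cs σW τ₁))| := by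
    rw [abs_sub_comm]
    exact le_trans (by linarith) (le_abs_self _)
  linarith

/-- **The two-sided wire at one point kills the outer-tempered condition there** (any `ε < 1/3`). -/
theorem not_outerTemperedCond_of_wireAt₂ {N : ℕ} {ρ : G →* Matrix (Fin N) (Fin N) ℂ} {β : ℝ} {b n : ℕ}
    {ε δ : ℝ} (hW : WireAt₂ ρ β b n δ) (hε : ε < 1 / 3) : ¬ OuterTemperedCond ρ β b n ε δ := by
  intro hO
  obtain ⟨w, hw, Y, cs₁, cs₂, σW, f, E₀₁, E₀₂, E₁₁, E₁₂, ζ₀₁, ζ₀₂, ζ₁₁, ζ₁₂, S₀₁, S₀₂, S₁₁, S₁₂, hY, h0Y, hne,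
    hcs₁, hcs₁', hcs₂, hcs₂', hfcyl, hfmeas, hf01, hE₀₁, hE₀₂, hE₁₁, hE₁₂, hS₀₁, hS₀₂, hS₁₁, hS₁₂,
    hlo, hhi⟩ := hW
  obtain ⟨Good, -, hGdep, hmix, hrare⟩ := hO w hw
  have meet : ∀ (c : Fin 4 → ℤ) (E' : Finset (Literature.MathematicalPhysics.QuantumLattice.ZdEdge 4))
      (ζ : LGConfig 4 G) (S : Set (LGConfig 4 G)), cellEdges w c ⊆ E' →
      ENNReal.ofReal δ < ymSpecification ρ β E' ζ S → ∃ τ ∈ S, τ ∈ Good c := by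
    intro c E' ζ S hE' hS
    by_contra h
    have hsub : S ⊆ (Good c)ᶜ := fun τ hτ hτG => h ⟨τ, hτ, hτG⟩
    exact lt_irrefl _ (lt_of_lt_of_le hS ((measure_mono hsub).trans (hrare c E' hE' ζ)))
  obtain ⟨τ₀₁, hτ₀₁S, hτ₀₁G⟩ := meet cs₁ E₀₁ ζ₀₁ S₀₁ hE₀₁ hS₀₁
  obtain ⟨τ₀₂, hτ₀₂S, hτ₀₂G⟩ := meet cs₂ E₀₂ ζ₀₂ S₀₂ hE₀₂ hS₀₂
  obtain ⟨τ₁₁, hτ₁₁S, hτ₁₁G⟩ := meet cs₁ E₁₁ ζ₁₁ S₁₁ hE₁₁ hS₁₁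
  obtain ⟨τ₁₂, hτ₁₂S, hτ₁₂G⟩ := meet cs₂ E₁₂ ζ₁₂ S₁₂ hE₁₂ hS₁₂
  -- evaluation of the double splice on the two cap cells and off them
  have ev₂ : ∀ τ₁ τ₂ : LGConfig 4 G, ∀ e ∈ cellEdges w cs₂, splice₂ w cs₁ cs₂ σW τ₁ τ₂ e = τ₂ e :=
    fun τ₁ τ₂ e he => by simp [splice₂, splice, he]
  have ev₁ : ∀ τ₁ τ₂ : LGConfig 4 G, ∀ e ∈ cellEdges w cs₁, splice₂ w cs₁ cs₂ σW τ₁ τ₂ e = τ₁ e :=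
    fun τ₁ τ₂ e he => by
      have he₂ : e ∉ cellEdges w cs₂ := not_mem_cellEdges_of_ne hw hne he
      simp [splice₂, splice, he, he₂]
  have ev₀ : ∀ τ₁ τ₂ : LGConfig 4 G, ∀ e, e ∉ cellEdges w cs₁ → e ∉ cellEdges w cs₂ →
      splice₂ w cs₁ cs₂ σW τ₁ τ₂ e = σW e :=
    fun τ₁ τ₂ e he₁ he₂ => by simp [splice₂, splice, he₁, he₂]
  have good₁ : ∀ τ₁ τ₂, τ₁ ∈ Good cs₁ → splice₂ w cs₁ cs₂ σW τ₁ τ₂ ∈ Good cs₁ := by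
    intro τ₁ τ₂ hτ
    exact (hGdep cs₁ (fun e he => ev₁ τ₁ τ₂ e (Finset.mem_coe.1 he))).mpr hτ
  have good₂ : ∀ τ₁ τ₂, τ₂ ∈ Good cs₂ → splice₂ w cs₁ cs₂ σW τ₁ τ₂ ∈ Good cs₂ := by
    intro τ₁ τ₂ hτ
    exact (hGdep cs₂ (fun e he => ev₂ τ₁ τ₂ e (Finset.mem_coe.1 he))).mpr hτ
  set σ := splice₂ w cs₁ cs₂ σW τ₀₁ τ₀₂ with hσ
  set σ' := splice₂ w cs₁ cs₂ σW τ₁₁ τ₁₂ with hσ'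
  have hagree : ∀ c ∈ windowCellsPlus n, c ∉ Y →
      ((∀ e ∈ cellEdges w c, σ e = σ' e) ∨ (c ∉ windowCells n ∧ σ ∈ Good c ∧ σ' ∈ Good c)) := by
    intro c _ _
    by_cases hc₁ : c = cs₁
    · subst hc₁
      exact Or.inr ⟨hcs₁', good₁ _ _ hτ₀₁G, good₁ _ _ hτ₁₁G⟩
    · by_cases hc₂ : c = cs₂
      · subst hc₂
        exact Or.inr ⟨hcs₂', good₂ _ _ hτ₀₂G, good₂ _ _ hτ₁₂G⟩
      · exact Or.inl fun e he => by
          rw [hσ, hσ', ev₀ τ₀₁ τ₀₂ e (not_mem_cellEdges_of_ne hw hc₁ he) (not_mem_cellEdges_of_ne hw hc₂ he),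
            ev₀ τ₁₁ τ₁₂ e (not_mem_cellEdges_of_ne hw hc₁ he) (not_mem_cellEdges_of_ne hw hc₂ he)]
  have key := hmix Y hY h0Y _ _ hagree f hfcyl hfmeas hf01
  have h1 := hlo τ₀₁ hτ₀₁S τ₀₂ hτ₀₂S
  have h2 := hhi τ₁₁ hτ₁₁S τ₁₂ hτ₁₂S
  have h3 : (1 : ℝ) / 3 ≤ |(∫ U, f U ∂(ymSpecification ρ β (regionEdges w Y) σ)) -
      ∫ U, f U ∂(ymSpecification ρ β (regionEdges w Y) σ')| := by
    rw [abs_sub_comm]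
    exact le_trans (by linarith) (le_abs_self _)
  linarith

/-- **H kills the v10 certificate**: `BoundaryOrderWire' r.ρ → ¬ OuterCertificate r a` for every admissible
unit map `a` (positive, `→ 0`). -/
theorem outerCertificate_false_of_wire' {r : LatticeRep G} {a : ℝ → ℝ}
    (hW : BoundaryOrderWire' r.ρ) (hapos : ∀ β, 0 < a β) (ha : Tendsto a atTop (𝓝 0)) :
    ¬ OuterCertificate r a := by
  rintro ⟨ℓ, hℓ, n, ε, hn, hε0, hεM, hcert⟩
  obtain ⟨δ, hδ, b₀, β₀, hwire⟩ := hW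
  obtain ⟨β₂, hβ₂⟩ := hcert δ hδ
  -- `ε < 1/3` from `ε · M(n) < 1`, `M(n) ≥ 16`
  have h16 : 16 ≤ (4 * n + 3) ^ 4 - (4 * n + 1) ^ 4 := by
    apply Nat.le_sub_of_add_le
    calc 16 + (4 * n + 1) ^ 4
        ≤ 16 + (4 * n + 1) ^ 4 + (8 * (4 * n + 1) ^ 3 + 24 * (4 * n + 1) ^ 2 + 32 * (4 * n + 1)) :=
          Nat.le_add_right _ _
      _ = (4 * n + 3) ^ 4 := by ring
  have hM : (16 : ℝ) ≤ (((4 * n + 3) ^ 4 - (4 * n + 1) ^ 4 : ℕ) : ℝ) := by exact_mod_cast h16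
  have hε3 : ε < 1 / 3 := by nlinarith
  -- a large `β` with `⌈ℓ / a β⌉₊ ≥ b₀`
  have hc : 0 < ℓ / ((b₀ : ℝ) + 1) := div_pos hℓ (by positivity)
  obtain ⟨N₀, hN₀⟩ := eventually_atTop.1 (ha.eventually (gt_mem_nhds hc))
  set β := max (max N₀ β₀) β₂ with hβdef
  have hNβ : N₀ ≤ β := le_trans (le_max_left _ _) (le_max_left _ _)
  have hβ₀β : β₀ ≤ β := le_trans (le_max_right _ _) (le_max_left _ _)
  have hβ₂β : β₂ ≤ β := le_max_right _ _
  have hb : b₀ ≤ ⌈ℓ / a β⌉₊ := by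
    have h1 : a β < ℓ / ((b₀ : ℝ) + 1) := hN₀ β hNβ
    have h2 : ℓ / (ℓ / ((b₀ : ℝ) + 1)) < ℓ / a β := div_lt_div_of_pos_left hℓ (hapos β) h1
    have h3 : ℓ / (ℓ / ((b₀ : ℝ) + 1)) = (b₀ : ℝ) + 1 := by field_simp
    have h4 : (b₀ : ℝ) < ℓ / a β := by linarith
    exact (Nat.lt_ceil.2 h4).le
  rcases hwire _ hb β hβ₀β n hn with h | h
  · exact not_outerTemperedCond_of_wireAt' h hε3 (hβ₂ β hβ₂β)
  · exact not_outerTemperedCond_of_wireAt₂ h hε3 (hβ₂ β hβ₂β)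

end Defs

/-! ## §3 The #31 shape with H in final form -/

/-- **#31 shape, typed:** a non-trivial `(G, r, a)` (compact simple `G`, `LowerBounds G r a`) whose Wilson
kernels carry a boundary-order wire refutes `IROuterCertificate`. -/
theorem irOuterCertificate_false_of_witness'
    (h : ∃ (G : Type) (_ : Group G) (_ : TopologicalSpace G) (_ : IsTopologicalGroup G) (_ : CompactSpace G),
      IsCompactSimpleLieGroup G ∧ (letI : MeasurableSpace G := borel G; haveI : BorelSpace G := ⟨rfl⟩;
        ∃ (r : LatticeRep G) (a : ℝ → ℝ), (∀ β, 0 < a β) ∧ Tendsto a atTop (𝓝 0) ∧ LowerBounds G r a ∧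
          BoundaryOrderWire' r.ρ)) :
    ¬ IROuterCertificate := by
  intro hC
  obtain ⟨G, _, _, _, _, hG, r, a, hapos, ha, hLB, hW⟩ := h
  letI : MeasurableSpace G := borel G
  haveI : BorelSpace G := ⟨rfl⟩
  exact outerCertificate_false_of_wire' hW hapos ha (hC G hG r a hapos ha hLB)

/-- **`IROuterCertificate ∧ NT → False` modulo the wire for `SU(2)`** (stated as `NT → ¬ IROuterCertificate`
under H): if every lattice representation of `SU(2)` carries a boundary-order wire, the route's non-triviality
leaf `NT` refutes the v10 certificate. -/
theorem irOuterCertificate_false_of_nt_of_wireSU2'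
    (hW : letI : MeasurableSpace (Matrix.specialUnitaryGroup (Fin 2) ℂ) :=
        borel (Matrix.specialUnitaryGroup (Fin 2) ℂ);
      haveI : BorelSpace (Matrix.specialUnitaryGroup (Fin 2) ℂ) := ⟨rfl⟩;
      ∀ r : LatticeRep (Matrix.specialUnitaryGroup (Fin 2) ℂ), BoundaryOrderWire' r.ρ)
    (hNT : Summit.QuantumFields.YangMills.Theses.BalabanLadder.NT) : ¬ IROuterCertificate := by
  intro hC
  have hG : IsCompactSimpleLieGroup (Matrix.specialUnitaryGroup (Fin 2) ℂ) :=
    isCompactSimpleLieGroup_specialUnitaryGroup isSimpleCompactGroup_specialUnitaryGroup_holds le_rfl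
  letI : MeasurableSpace (Matrix.specialUnitaryGroup (Fin 2) ℂ) := borel _
  haveI : BorelSpace (Matrix.specialUnitaryGroup (Fin 2) ℂ) := ⟨rfl⟩
  obtain ⟨r, a, hapos, ha, hLB⟩ := hNT (Matrix.specialUnitaryGroup (Fin 2) ℂ) hG
  exact outerCertificate_false_of_wire' (hW r) hapos ha (hC _ hG r a hapos ha hLB)

end Summit.QuantumFields.YangMills.Cruxes.IR.OuterCertWire

end
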